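import Summits.Ventures.PercRepro.SixFourPLList
import Summits.Ventures.PercRepro.SixFourT4Final

/-!
# PercRepro — C-025 at `(6,4)`, §22.12: the profile-list bound as a named hypothesis, and `SixTwoSix` from it (p3, gen 9)

mine-2's `MINE2-RLS.md` §22.12 reduces the plane-line case §22.6 (the hypothesis `SixTwoSix` of `SixFourT4Final.lean`)
to three things: (i) every plane-line solid `G` (simple, rank `4`, not generic, planes `≤ 7` points, `10 ≤ g ≤ 14`) has a
coarse profile `π(G)` in the finite list `LIST` of `SixFourPLList.lean` (22.12.5, profile completeness; none exists
at `g = 14`); (ii) `J₄(G) ≥ Jlow(π(G))` (Theorem 22.12, from the identity 22.1, the lpp identity 22.2, the plane list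
22.4(b) and the covering-pair Lemma 22.12.3); (iii) `Jlow(π) > 0` on `LIST` (22.12.6, `LIST_pos`, in the kernel).
This file states (i) + (ii) together as the ordinary `Prop` **`PLBound`** — «every plane-line `G` has some `π ∈ LIST`
with `15·Jlow(π) ≤ 15·J₄(G)`» — and proves **`sixTwoSix_of_PLBound : PLBound → SixTwoSix`** from the finite check.
Discharging `PLBound` (the matroid side of §22.12) is the remaining step of the `SixTwoSix` path.
-/

namespace PercRepro.SixFour

open Finset ThmH

universe u

/-- **The profile-list bound (§22.12 (i) + (ii))**: for every simple matroid `M` (on a type in `Type`) and every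
non-generic rank-`4` set `G ⊆ E` with plane traces `≤ 7` points and `10 ≤ g ≤ 14`, some coarse profile `π ∈ LIST`
has `15·Jlow(π) ≤ 15·J₄(G)`. -/
def PLBound : Prop :=
  ∀ {β : Type} [DecidableEq β] (M : Matroid β) [M.Finite] (G : Finset β), Simple M → G ⊆ gr M →
    M.eRk (G : Set β) = 4 → ¬ Generic M G → (∀ P ∈ planes M, (P ∩ G).card ≤ 7) → 10 ≤ G.card →
    G.card ≤ 14 → ∃ π ∈ PL.LIST, (PL.J15 π : ℚ) ≤ 15 * J M G 4

/-- **`SixTwoSix` from the profile-list bound and the finite check**: `PLBound → SixTwoSix` (the plane-line case of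
Theorem 22 in universe `0`), since `0 < 15·Jlow(π) ≤ 15·J₄(G)` for the profile `π ∈ LIST` of `G`. -/
theorem sixTwoSix_of_PLBound (h : PLBound) : SixTwoSix.{0} := by
  intro β _ M _ G hs hG hr hgen hpl hg hg'
  obtain ⟨π, hπ, hle⟩ := h M G hs hG hr hgen hpl hg hg'
  have hpos : (0 : ℚ) < PL.J15 π := by exact_mod_cast PL.J15_pos_of_mem hπ
  linarith

end PercRepro.SixFour
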